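import Literature.Analysis.FluidPDE.PassiveVectorTensorEnergyDecay
import Summits.AnomalousDissipation.AnomalousDissipation.Theorems.SolenoidalFractalHomogenisationLagrangianStepCellChainLinks
import Mathlib.MeasureTheory.Integral.IntervalIntegral.AbsolutelyContinuousFun
import HarnessLib

/-!
# K1L_D `LagrangianRenormalisationStepDesign` (stmt-AnomalousDissipation-27980), W7 engine sub-piece S1a / `stub_cellLawV0_IS` V0:
# the ENERGY of a weak tensor passive-vector solution as an ABSOLUTELY CONTINUOUS function of time, with the symbol-form
# dissipation density as a.e. derivative (helper; `--supports stmt-AnomalousDissipation-27980`)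

Summits-side helper file of route `SolenoidalFractalHomogenisation` (prover seat `ad-k1l-cellLawV-w1` g4; regularity interface of the W7 engine agreed
with the assembly owner ad-sawtooth-k1loc-p1 g11 and p5 g10's AC Grönwall `…W7EngineSpineAC`).  Everything proved; no definitions, no named facts, no
sorry.  For `h : Torus.IsWeakTensorPassiveVectorOn 0 T 𝔸 b w₀ w` with a constant tensor in a Legendre–Hadamard window `NearIso 𝔸 lo hi`, `0 < lo`, an
essentially bounded carrier and an `L²` weakly divergence-free datum, **`exists_energyRep`** packages the energy equality of the tree
(`PassiveVectorTensorEnergyDecay.ae_tendsto_setIntegral_symbForm`: `∫₀ᵗ Q_N → (‖w₀‖² − ‖w t‖²)/2`, `Q_N = 4π² Σ_{|k|≤N} Re⟪ŵ_k, T_𝔸(k) ŵ_k⟫`) into the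
regularity format of the W7 hypocoercivity functional:
there are `E Q : ℝ → ℝ` with `E 0 = ‖w₀‖²`, `E t = ‖w₀‖² − 2∫₀ᵗ Q` on `[0,T]`, `E` continuous and antitone on `[0,T]` and ABSOLUTELY CONTINUOUS on every
`[a,b] ⊆ [0,T]`, `E t = ‖w t‖²` for a.e. `t`, `Q ∈ L¹(0,T)`, `HasDerivAt E (−2 Q t) t` for a.e. `t ∈ (0,T)`, and the dissipation density dominates every
finite block of the symbol form: `4π² Σ_{k∈S} Re⟪ŵ(t)(k), T_𝔸(k) ŵ(t)(k)⟫ ≤ Q t` a.e., each term obeying `lo·|k|²·‖ŵ(t)(k)‖² ≤ Re⟪ŵ(t)(k), T_𝔸(k)ŵ(t)(k)⟫`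
(so a three-mode functional may spend the dissipation of the modes it watches and drop the rest with sign).  `Q` is the real part of
`Qs = sup_N ofReal Q_N` (monotone convergence; finiteness of `∫⁻_{(0,T)} Qs ≤ ‖w₀‖²/2` by exhausting `(0,T)` with `(0, t_m]`).  The cell carrier
`W₁.cell n` of a lattice word is essentially bounded (`memLp_top_stLift_cell`): `exists_energyRep_cell`.
NOT a proof of any registered stub, of the crux, or of anomalous dissipation; rung F-D1.A0 infrastructure.
-/

set_option linter.dupNamespace false

noncomputable section

namespace Summit.AnomalousDissipation.AnomalousDissipation.Theorems.SolenoidalFractalHomogenisation.LagrangianStep.CellChain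

open Set MeasureTheory Filter Topology Function Complex UnitAddTorus
open scoped InnerProductSpace ComplexConjugate ENNReal
open Literature.Analysis Literature.Analysis.FunctionSpaces Literature.Analysis.FunctionSpaces.Torus
open Literature.Analysis.FluidPDE Literature.Analysis.FluidPDE.Torus Literature.Analysis.FluidPDE.LatticeShear
open Summit.AnomalousDissipation.AnomalousDissipation.Theorems.SolenoidalFractalHomogenisation.RealisedQuasiStaticCellLaw

variable {d : Type*} [Fintype d] [DecidableEq d]

/-- A monotone function on `[0,T)` bounded a.e. on `(0,T)` is bounded everywhere on `[0,T)` (every `(t,T)` has positive measure, so it contains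
a point of the full-measure set). [folklore] -/
theorem le_of_ae_le_of_monotoneOn {T C : ℝ} {f : ℝ → ℝ≥0∞} (hmono : MonotoneOn f (Ico 0 T))
    (hae : ∀ᵐ t ∂(volume.restrict (Ioo 0 T)), f t ≤ ENNReal.ofReal C) {t : ℝ} (ht : t ∈ Ico 0 T) : f t ≤ ENNReal.ofReal C := by
  have hsub : Ioo t T ⊆ Ioo 0 T := Ioo_subset_Ioo_left ht.1
  have hae' : ∀ᵐ s ∂(volume.restrict (Ioo t T)), f s ≤ ENNReal.ofReal C ∧ s ∈ Ioo t T :=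
    (ae_restrict_of_ae_restrict_of_subset hsub hae).and (ae_restrict_mem measurableSet_Ioo)
  have hne : (volume.restrict (Ioo t T) : Measure ℝ) ≠ 0 := by
    rw [Ne, Measure.restrict_eq_zero, Real.volume_Ioo]
    exact (ENNReal.ofReal_pos.2 (by linarith [ht.2])).ne'
  haveI : (ae (volume.restrict (Ioo t T) : Measure ℝ)).NeBot := ae_neBot.2 hne
  obtain ⟨s, hs, hsI⟩ := hae'.exists
  exact (hmono ht ⟨ht.1.trans hsI.1.le, hsI.2⟩ hsI.1.le).trans hs

/-- **The energy of a weak tensor passive-vector solution as an absolutely continuous function of time.**  See the module docstring.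
[cite: Temam1984, Ch. III §1 Lemma 1.2 (energy inequality)] [cite: RobinsonRodrigoSadowski2016, §4.2 (4.20)] -/
theorem exists_energyRep {A T : ℝ} (hA : A = 0) {𝔸 : Torus.Visc4 d} {b w : ℝ → UnitAddTorus d → EuclideanSpace ℝ d}
    {w₀ : UnitAddTorus d → EuclideanSpace ℝ d} (h : Torus.IsWeakTensorPassiveVectorOn A T 𝔸 b w₀ w) (hT : 0 < T)
    {lo hi : ℝ} (h𝔸 : Torus.NearIso 𝔸 lo hi) (hlo : 0 < lo)
    (hw₀ : MemLp w₀ 2 volume) (hdiv₀ : FunctionSpaces.Torus.IsWeaklyDivFree w₀)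
    (hb : MemLp (FunctionSpaces.Torus.stLift b) ∞ (volume.restrict (Ioo 0 T ×ˢ univ))) :
    ∃ E Q : ℝ → ℝ,
      E 0 = ∫ x, ‖w₀ x‖ ^ 2 ∧
      (∀ t ∈ Icc 0 T, E t = (∫ x, ‖w₀ x‖ ^ 2) - 2 * ∫ s in (0:ℝ)..t, Q s) ∧
      ContinuousOn E (Icc 0 T) ∧
      AntitoneOn E (Icc 0 T) ∧
      (∀ a ∈ Icc 0 T, ∀ b' ∈ Icc 0 T, AbsolutelyContinuousOnInterval E a b') ∧
      (∀ᵐ t ∂(volume.restrict (Ioo 0 T)), E t = ∫ x, ‖w t x‖ ^ 2) ∧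
      IntegrableOn Q (Ioo 0 T) ∧
      (∀ᵐ t ∂(volume.restrict (Ioo 0 T)), 0 ≤ Q t) ∧
      (∀ᵐ t ∂(volume : Measure ℝ), t ∈ Ioo 0 T → HasDerivAt E (-(2 * Q t)) t) ∧
      (∀ᵐ t ∂(volume.restrict (Ioo 0 T)), ∀ S : Finset (d → ℤ),
        4 * Real.pi ^ 2 * ∑ k ∈ S, (⟪mFourierCoeff (EuclideanSpace.complexify ∘ w t) k,
          Torus.symbT 𝔸 k (mFourierCoeff (EuclideanSpace.complexify ∘ w t) k)⟫_ℂ).re ≤ Q t) ∧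
      (∀ᵐ t ∂(volume.restrict (Ioo 0 T)), ∀ k : d → ℤ,
        0 ≤ (⟪mFourierCoeff (EuclideanSpace.complexify ∘ w t) k,
          Torus.symbT 𝔸 k (mFourierCoeff (EuclideanSpace.complexify ∘ w t) k)⟫_ℂ).re ∧
        lo * (freqNormSq k * ‖mFourierCoeff (EuclideanSpace.complexify ∘ w t) k‖ ^ 2) ≤
          (⟪mFourierCoeff (EuclideanSpace.complexify ∘ w t) k,
            Torus.symbT 𝔸 k (mFourierCoeff (EuclideanSpace.complexify ∘ w t) k)⟫_ℂ).re) := by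
  classical
  subst hA
  -- ### notation (as in `PassiveVectorTensorEnergyDecay.ae_integral_norm_sq_le_exp`)
  set X : (d → ℤ) → ℝ → EuclideanSpace ℂ d := fun k s =>
    mFourierCoeff (EuclideanSpace.complexify ∘ w s) k with hX
  set QN : ℕ → ℝ → ℝ := fun N s => 4 * Real.pi ^ 2 * ∑ k ∈ freqBall N,
    (⟪X k s, Torus.symbT 𝔸 k (X k s)⟫_ℂ).re with hQN
  set Ef : ℝ → ℝ := fun s => ∫ x, ‖w s x‖ ^ 2 with hEf
  set E₀ : ℝ := ∫ x, ‖w₀ x‖ ^ 2 with hE₀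
  set Qs : ℝ → ℝ≥0∞ := fun s => ⨆ N : ℕ, ENNReal.ofReal (QN N s) with hQs
  -- ### a.e.-in-`s` facts from the tree
  have hQint : ∀ N, IntegrableOn (QN N) (Ioo 0 T) := fun N => h.integrableOn_symbForm N
  have hmono : ∀ᵐ s ∂(volume.restrict (Ioo 0 T)), Monotone fun N : ℕ => QN N s := h.ae_symbForm_mono h𝔸 hlo.le
  have hterm : ∀ᵐ s ∂(volume.restrict (Ioo 0 T)), ∀ k, 0 ≤ (⟪X k s, Torus.symbT 𝔸 k (X k s)⟫_ℂ).re :=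
    h.ae_re_inner_symbT_nonneg h𝔸 hlo.le
  have hQnn : ∀ᵐ s ∂(volume.restrict (Ioo 0 T)), ∀ N, 0 ≤ QN N s := by
    filter_upwards [hterm] with s hs
    intro N
    exact mul_nonneg (by positivity) (Finset.sum_nonneg fun k _ => hs k)
  have hQm : ∀ N, AEMeasurable (fun s => ENNReal.ofReal (QN N s)) (volume.restrict (Ioo 0 T)) := fun N =>
    (hQint N).aestronglyMeasurable.aemeasurable.ennreal_ofReal
  have hQsm : AEMeasurable Qs (volume.restrict (Ioo 0 T)) := AEMeasurable.iSup hQm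
  -- ### the energy identity with `Qs`, at a.e. `t`
  have hEq : ∀ᵐ t ∂(volume.restrict (Ioo 0 T)), ∫⁻ s in Ioc 0 t, Qs s = ENNReal.ofReal ((E₀ - Ef t) / 2) := by
    filter_upwards [h.ae_tendsto_setIntegral_symbForm h𝔸 hlo hw₀ hdiv₀ hb, ae_restrict_mem measurableSet_Ioo] with t ht htI
    have hsub : Ioc 0 t ⊆ Ioo 0 T := Ioc_subset_Ioo_right htI.2
    have hmc : ∫⁻ s in Ioc 0 t, Qs s = ⨆ N : ℕ, ∫⁻ s in Ioc 0 t, ENNReal.ofReal (QN N s) := by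
      rw [hQs]
      exact lintegral_iSup' (fun N => (hQm N).mono_measure (Measure.restrict_mono hsub le_rfl))
        (ae_restrict_of_ae_restrict_of_subset hsub (hmono.mono fun s hs N N' hNN' => ENNReal.ofReal_le_ofReal (hs hNN')))
    have heq : ∀ N, ∫⁻ s in Ioc 0 t, ENNReal.ofReal (QN N s) = ENNReal.ofReal (∫ s in Ioc 0 t, QN N s) := fun N =>
      (ofReal_integral_eq_lintegral_ofReal ((hQint N).mono_set hsub)
        (ae_restrict_of_ae_restrict_of_subset hsub (hQnn.mono fun s hs => hs N))).symm
    simp_rw [heq] at hmc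
    rw [hmc]
    have hmono' : Monotone fun N : ℕ => ENNReal.ofReal (∫ s in Ioc 0 t, QN N s) := by
      intro N N' hNN'
      refine ENNReal.ofReal_le_ofReal (integral_mono_ae ((hQint N).mono_set hsub) ((hQint N').mono_set hsub) ?_)
      exact ae_restrict_of_ae_restrict_of_subset hsub (hmono.mono fun s hs => hs hNN')
    exact tendsto_nhds_unique (tendsto_atTop_iSup hmono') (ENNReal.tendsto_ofReal ht)
  -- the energy is nonnegative and below the initial energy a.e.
  have hEle : ∀ᵐ s ∂(volume.restrict (Ioo 0 T)), Ef s ≤ E₀ := by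
    filter_upwards [h.ae_energy_ineq h𝔸 hlo hw₀ hdiv₀ hb] with s hs
    have h1 : ENNReal.ofReal (Ef s) ≤ ENNReal.ofReal E₀ := le_trans le_self_add hs
    exact (ENNReal.ofReal_le_ofReal_iff (integral_nonneg fun x => sq_nonneg _)).1 h1
  have hEnn : ∀ s, 0 ≤ Ef s := fun s => integral_nonneg fun x => sq_nonneg _
  -- ### finiteness of the total dissipation: `∫⁻_{(0,T)} Qs ≤ E₀/2`
  have hbound_ae : ∀ᵐ t ∂(volume.restrict (Ioo 0 T)), ∫⁻ s in Ioc 0 t, Qs s ≤ ENNReal.ofReal (E₀ / 2) := by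
    filter_upwards [hEq] with t ht
    rw [ht]
    exact ENNReal.ofReal_le_ofReal (by linarith [hEnn t])
  have hmonoI : MonotoneOn (fun t => ∫⁻ s in Ioc 0 t, Qs s) (Ico 0 T) :=
    fun t₁ _ t₂ _ h12 => lintegral_mono_set (Ioc_subset_Ioc_right h12)
  have hbound : ∀ t ∈ Ico 0 T, ∫⁻ s in Ioc 0 t, Qs s ≤ ENNReal.ofReal (E₀ / 2) := fun t ht =>
    le_of_ae_le_of_monotoneOn hmonoI hbound_ae ht
  have hfinT : ∫⁻ s in Ioo 0 T, Qs s ≤ ENNReal.ofReal (E₀ / 2) := by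
    -- exhaust `(0,T)` by `(0, T(m+1)/(m+2)]`
    set tm : ℕ → ℝ := fun m => T * (((m : ℝ) + 1) / ((m : ℝ) + 2)) with htm
    have htm_mem : ∀ m, tm m ∈ Ico 0 T := by
      intro m
      have h1 : (0:ℝ) < (m:ℝ) + 2 := by positivity
      have h2 : ((m:ℝ) + 1) / ((m:ℝ) + 2) < 1 := by rw [div_lt_one h1]; linarith
      refine ⟨by positivity, ?_⟩
      calc T * (((m : ℝ) + 1) / ((m : ℝ) + 2)) < T * 1 := mul_lt_mul_of_pos_left h2 hT
        _ = T := mul_one T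
    have hmono_tm : Monotone tm := by
      intro m m' hmm'
      simp only [htm]
      refine mul_le_mul_of_nonneg_left ?_ hT.le
      have h1 : (0:ℝ) < (m:ℝ) + 2 := by positivity
      have h2 : (0:ℝ) < (m':ℝ) + 2 := by positivity
      rw [div_le_div_iff₀ h1 h2]
      have : (m:ℝ) ≤ m' := by exact_mod_cast hmm'
      nlinarith
    have hU : Ioo 0 T = ⋃ m : ℕ, Ioc 0 (tm m) := by
      ext s
      simp only [mem_Ioo, mem_iUnion, mem_Ioc]
      constructor
      · rintro ⟨hs0, hsT⟩
        -- `m + 2 ≥ T/(T - s)` gives `tm m ≥ s`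
        obtain ⟨m, hm⟩ := exists_nat_ge (T / (T - s))
        refine ⟨m, hs0, ?_⟩
        have hTs : 0 < T - s := by linarith
        have h1 : (0:ℝ) < (m:ℝ) + 2 := by positivity
        have h3 : T ≤ (T - s) * ((m:ℝ) + 2) := by
          rw [div_le_iff₀ hTs] at hm
          nlinarith
        simp only [htm]
        rw [mul_div_assoc', le_div_iff₀ h1]
        nlinarith
      · rintro ⟨m, hs0, hsm⟩
        exact ⟨hs0, lt_of_le_of_lt hsm (htm_mem m).2⟩
    have hdir : Directed (· ⊆ ·) fun m : ℕ => Ioc (0:ℝ) (tm m) :=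
      Monotone.directed_le fun a b hab => Ioc_subset_Ioc_right (hmono_tm hab)
    rw [hU, setLIntegral_iUnion_of_directed _ hdir]
    exact iSup_le fun m => hbound (tm m) (htm_mem m)
  have hfinT' : ∫⁻ s in Ioo 0 T, Qs s ≠ ⊤ := ne_top_of_le_ne_top ENNReal.ofReal_ne_top hfinT
  -- the same facts on `(0,T]` (the endpoint is null)
  have hμ : (volume.restrict (Ioc 0 T) : Measure ℝ) = volume.restrict (Ioo 0 T) := Measure.restrict_congr_set Ioo_ae_eq_Ioc.symm
  have hfinIoc : ∫⁻ s in Ioc 0 T, Qs s ≠ ⊤ := by rw [hμ]; exact hfinT'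
  have hfin : ∀ t, t ≤ T → ∫⁻ s in Ioc 0 t, Qs s ≠ ⊤ := fun t ht =>
    ne_top_of_le_ne_top hfinIoc (lintegral_mono_set (Ioc_subset_Ioc_right ht))
  have hQsmT : AEMeasurable Qs (volume.restrict (Ioc 0 T)) := by rw [hμ]; exact hQsm
  -- ### the real dissipation density `Q = Qs.toReal`, integrable on `(0,T)`
  set Q : ℝ → ℝ := fun s => (Qs s).toReal with hQdef
  have hQi : IntegrableOn Q (Ioo 0 T) := integrable_toReal_of_lintegral_ne_top hQsm hfinT'
  have hQs_lt : ∀ᵐ s ∂(volume.restrict (Ioo 0 T)), Qs s < ⊤ := ae_lt_top' hQsm hfinT'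
  have hQs_ltT : ∀ᵐ s ∂(volume.restrict (Ioc 0 T)), Qs s < ⊤ := by rw [hμ]; exact hQs_lt
  have hIQ : ∀ t ∈ Icc 0 T, ∫ s in (0:ℝ)..t, Q s = (∫⁻ s in Ioc 0 t, Qs s).toReal := by
    intro t ht
    have hle : (volume.restrict (Ioc 0 t) : Measure ℝ) ≤ volume.restrict (Ioc 0 T) :=
      Measure.restrict_mono (Ioc_subset_Ioc_right ht.2) le_rfl
    rw [intervalIntegral.integral_of_le ht.1, hQdef]
    exact integral_toReal (hQsmT.mono_measure hle) (ae_mono hle hQs_ltT)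
  -- ### the representative
  set E : ℝ → ℝ := fun t => E₀ - 2 * ∫ s in (0:ℝ)..t, Q s with hEdef
  have hQii : IntervalIntegrable Q volume 0 T := (intervalIntegrable_iff_integrableOn_Ioo_of_le hT.le).2 hQi
  have h0T : (0:ℝ) ∈ uIcc 0 T := by rw [uIcc_of_le hT.le]; exact ⟨le_rfl, hT.le⟩
  refine ⟨E, Q, ?_, fun t _ => rfl, ?_, ?_, ?_, ?_, hQi, ae_of_all _ fun t => ENNReal.toReal_nonneg, ?_, ?_, ?_⟩
  · -- `E 0 = E₀`
    simp only [hEdef, intervalIntegral.integral_same, mul_zero, sub_zero]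
  · -- continuity on `[0,T]`
    have hi : IntegrableOn Q (uIcc 0 T) volume := by
      rw [uIcc_of_le hT.le, integrableOn_Icc_iff_integrableOn_Ioo]
      exact hQi
    have hc := intervalIntegral.continuousOn_primitive_interval (μ := volume) hi
    rw [uIcc_of_le hT.le] at hc
    exact continuousOn_const.sub (continuousOn_const.mul hc)
  · -- antitone on `[0,T]`
    intro t₁ ht₁ t₂ ht₂ h12
    simp only [hEdef]
    rw [hIQ t₁ ht₁, hIQ t₂ ht₂]
    have := ENNReal.toReal_mono (hfin t₂ ht₂.2) (lintegral_mono_set (μ := volume) (f := Qs) (Ioc_subset_Ioc_right h12))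
    linarith
  · -- absolute continuity on every `[a,b'] ⊆ [0,T]`
    intro a ha b' hb'
    have ha' : a ∈ uIcc 0 T := by rw [uIcc_of_le hT.le]; exact ha
    have hb'' : b' ∈ uIcc 0 T := by rw [uIcc_of_le hT.le]; exact hb'
    have hprim : AbsolutelyContinuousOnInterval (fun x => ∫ s in (0:ℝ)..x, Q s) a b' :=
      (hQii.absolutelyContinuousOnInterval_intervalIntegral h0T).mono (uIcc_subset_uIcc ha' hb'')
    have hconst : AbsolutelyContinuousOnInterval (fun _ : ℝ => E₀) a b' :=
      ((LipschitzWith.const E₀).lipschitzOnWith).absolutelyContinuousOnInterval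
    have hsum := hconst.add ((hprim.const_mul 2).neg)
    have e : E = (fun _ : ℝ => E₀) + -(fun x => 2 * ∫ s in (0:ℝ)..x, Q s) := by
      funext t
      simp only [hEdef, Pi.add_apply, Pi.neg_apply]
      ring
    rw [e]
    exact hsum
  · -- `E = ‖w t‖²` a.e.
    filter_upwards [hEq, hEle, ae_restrict_mem measurableSet_Ioo] with t ht hle htI
    simp only [hEdef]
    rw [hIQ t ⟨htI.1.le, htI.2.le⟩, ht, ENNReal.toReal_ofReal (by linarith)]
    ring
  · -- a.e. derivative
    filter_upwards [hQii.ae_hasDerivAt_integral] with t ht htI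
    have ht' : t ∈ uIcc 0 T := by rw [uIcc_of_le hT.le]; exact ⟨htI.1.le, htI.2.le⟩
    have hd := (ht ht' 0 h0T).const_mul (2:ℝ)
    exact hd.const_sub E₀
  · -- finite blocks of the symbol form are below `Q`
    filter_upwards [hQs_lt, hterm] with t hlt hnn S
    obtain ⟨N, hN⟩ := (Filter.tendsto_atTop.1 (tendsto_freqBall_atTop (d := d)) S).exists
    have h1 : 4 * Real.pi ^ 2 * ∑ k ∈ S, (⟪X k t, Torus.symbT 𝔸 k (X k t)⟫_ℂ).re ≤ QN N t := by
      simp only [hQN]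
      exact mul_le_mul_of_nonneg_left (Finset.sum_le_sum_of_subset_of_nonneg hN fun k _ _ => hnn k) (by positivity)
    have h2 : ENNReal.ofReal (QN N t) ≤ Qs t := le_iSup (fun N : ℕ => ENNReal.ofReal (QN N t)) N
    have h3 : QN N t ≤ (Qs t).toReal := (ENNReal.ofReal_le_iff_le_toReal hlt.ne).1 h2
    exact h1.trans h3
  · -- per-mode coercivity
    have htr := ae_all_iff.2 fun k => h.ae_sum_mul_mFourierCoeff_eq_zero k
    filter_upwards [hterm, htr] with t hnn htr' k
    exact ⟨hnn k, Torus.lo_mul_le_re_inner_symbT h𝔸 (htr' k)⟩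

/-- **The energy representative for the cell problem of a lattice word** (the cell carrier is essentially bounded, `memLp_top_stLift_cell`):
same conclusions for `h : IsWeakTensorPassiveVectorOn 0 T 𝔹 (W₁.cell n) F u` with `NearIso 𝔹 lo' hi'`, `0 < lo'`, and an `L²` weakly divergence-free
datum `F`. [cite: Temam1984, Ch. III §1 Lemma 1.2 (energy inequality)] -/
theorem exists_energyRep_cell {k₀ : ℕ} (W₁ : LatticeWord k₀) (n : ℕ) {T : ℝ} (hT : 0 < T) {𝔹 : Torus.Visc4 (Fin 3)} {lo' hi' : ℝ}
    (h𝔹 : Torus.NearIso 𝔹 lo' hi') (hlo' : 0 < lo')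
    {F : UnitAddTorus (Fin 3) → EuclideanSpace ℝ (Fin 3)} {u : ℝ → UnitAddTorus (Fin 3) → EuclideanSpace ℝ (Fin 3)}
    (hF : MemLp F 2 volume) (hFdiv : FunctionSpaces.Torus.IsWeaklyDivFree F)
    (h : Torus.IsWeakTensorPassiveVectorOn 0 T 𝔹 (W₁.cell n) F u) :
    ∃ E Q : ℝ → ℝ,
      E 0 = ∫ x, ‖F x‖ ^ 2 ∧
      (∀ t ∈ Icc 0 T, E t = (∫ x, ‖F x‖ ^ 2) - 2 * ∫ s in (0:ℝ)..t, Q s) ∧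
      ContinuousOn E (Icc 0 T) ∧
      AntitoneOn E (Icc 0 T) ∧
      (∀ a ∈ Icc 0 T, ∀ b' ∈ Icc 0 T, AbsolutelyContinuousOnInterval E a b') ∧
      (∀ᵐ t ∂(volume.restrict (Ioo 0 T)), E t = ∫ x, ‖u t x‖ ^ 2) ∧
      IntegrableOn Q (Ioo 0 T) ∧
      (∀ᵐ t ∂(volume.restrict (Ioo 0 T)), 0 ≤ Q t) ∧
      (∀ᵐ t ∂(volume : Measure ℝ), t ∈ Ioo 0 T → HasDerivAt E (-(2 * Q t)) t) ∧
      (∀ᵐ t ∂(volume.restrict (Ioo 0 T)), ∀ S : Finset (Fin 3 → ℤ),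
        4 * Real.pi ^ 2 * ∑ k ∈ S, (⟪mFourierCoeff (EuclideanSpace.complexify ∘ u t) k,
          Torus.symbT 𝔹 k (mFourierCoeff (EuclideanSpace.complexify ∘ u t) k)⟫_ℂ).re ≤ Q t) ∧
      (∀ᵐ t ∂(volume.restrict (Ioo 0 T)), ∀ k : Fin 3 → ℤ,
        0 ≤ (⟪mFourierCoeff (EuclideanSpace.complexify ∘ u t) k,
          Torus.symbT 𝔹 k (mFourierCoeff (EuclideanSpace.complexify ∘ u t) k)⟫_ℂ).re ∧
        lo' * (freqNormSq k * ‖mFourierCoeff (EuclideanSpace.complexify ∘ u t) k‖ ^ 2) ≤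
          (⟪mFourierCoeff (EuclideanSpace.complexify ∘ u t) k,
            Torus.symbT 𝔹 k (mFourierCoeff (EuclideanSpace.complexify ∘ u t) k)⟫_ℂ).re) :=
  exists_energyRep rfl h hT h𝔹 hlo' hF hFdiv (memLp_top_stLift_cell W₁ n T)

end Summit.AnomalousDissipation.AnomalousDissipation.Theorems.SolenoidalFractalHomogenisation.LagrangianStep.CellChain

end
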